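import Summits.QuantumFields.YangMills.Theorems.LuscherReductionDressedRitzPolyakovLiftTransplantReflect
import Summits.QuantumFields.YangMills.Theorems.LuscherReductionDressedRitzPolyakovLiftTransplantStaticsLR
import HarnessLib

/-!
# Line «polyakovlift» r7 on crux `DressedRitz` (stmt-QuantumFields-20205): S-STAT for HYPEROCTAHEDRALLY SEPARATED AL1 families, r7 radius floor

Fleet-service module of seat ym-infvol-p1 g7: the r7 twin (`TransplantBasisLR`, floor `1 ≤ R⁴Λ`) of `staticClauses_transplantL_of_hyperoctCert` (`…TransplantReflect`):
★★ `staticClauses_transplantLR_of_hyperoctCert` — both static clauses, every `C ≥ 0`, for the transplant basis of an AL1 family every excited pair of which carries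
opposite signs under some hyperoctahedral generator (transposition, reflection, parity), `β ≥ 1`, `(3·physLevel(k+1)/2)⁴·Λ < 1`, `1 ≤ R`, `1 ≤ R⁴Λ`, `RΛ ≤ 1/4`;
§2: the STUB TEXT ITSELF at level `k` — ★★ `staticsForLR_of_separationCert` (`StaticsForL (TransplantBasisLR k)` from pairwise `PairSeparated` of every r7 basis),
★★ `staticsForLR_of_le_one` (levels `k ≤ 1` OUTRIGHT: no excited pair), ★★ `staticsForLR_of_hyperoctCert` (from a flat-sign certificate on the AL1 families of `𝔥` at level `k`).

HONEST FRAMING: bookkeeping on the conditional femto rung R2b1; which AL1 families are separated is an open ONE-type classification of the low levels of `𝔥`;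
RG content above the first repeated isotype untouched; not infinite volume, not a gap, not Clay.
References: M. Lüscher, NPB 219 (1983) 233 [cite: Luscher1983, §3]; M. Lüscher, U. Wolff, NPB 339 (1990) 222 [cite: LuscherWolff1990].
-/

set_option autoImplicit false

noncomputable section

open MeasureTheory Filter Topology Real
open Literature.MathematicalPhysics.QuantumFieldTheory (GaugeConfig Site gaugeTransform configPerm)
open Literature.Analysis.OperatorTheory.YMMatrixModel
open scoped BigOperators

namespace Summit.QuantumFields.YangMills.Theorems.FemtoTransferGap.PolyakovLift

open Summit.QuantumFields.YangMills.Theorems.FemtoTransferGap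

variable {k : ℕ}

/-- ★★ **Both static clauses for hyperoctahedrally separated AL1 families, r7 radius floor.** [cite: Luscher1983, §3] [cite: LuscherWolff1990] -/
theorem staticClauses_transplantLR_of_hyperoctCert {L : ℕ} [NeZero L] {β : ℝ} (hβ : 1 ≤ β) {φ : GaugeConfig 3 L SU2 → ℝ} (hvac : IsRawVacuum β φ)
    {Λ R : ℝ} (hΛ : 0 < Λ) (hΛk : (3 / 2 * physLevel (k + 1)) ^ 4 * Λ < 1) (hR1 : 1 ≤ R) (hlo : 1 ≤ R ^ 4 * Λ) (hhi : R * Λ ≤ 1 / 4)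
    {f : Fin (k + 1) → ZM → ℝ} (hf : IsEigenFamily k f) (hpos : ∀ x, 0 < f 0 x)
    (hcert : ∀ i l : Fin k, i ≠ l →
      (∃ a b : Fin 3,
        ((∀ y, f i.succ (LinearIsometryEquiv.piLpCongrLeft 2 ℝ ℝ ((Equiv.swap a b).prodCongr (Equiv.refl (Fin 3))) y) = f i.succ y) ∧
            (∀ y, f l.succ (LinearIsometryEquiv.piLpCongrLeft 2 ℝ ℝ ((Equiv.swap a b).prodCongr (Equiv.refl (Fin 3))) y) = -f l.succ y)) ∨
          ((∀ y, f l.succ (LinearIsometryEquiv.piLpCongrLeft 2 ℝ ℝ ((Equiv.swap a b).prodCongr (Equiv.refl (Fin 3))) y) = f l.succ y) ∧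
            (∀ y, f i.succ (LinearIsometryEquiv.piLpCongrLeft 2 ℝ ℝ ((Equiv.swap a b).prodCongr (Equiv.refl (Fin 3))) y) = -f i.succ y))) ∨
      (∃ kx : Fin 3,
        ((∀ y, f i.succ (LinearIsometryEquiv.piLpCongrRight 2
              (fun q : Fin 3 × Fin 3 => if q.1 = kx then LinearIsometryEquiv.neg ℝ (E := ℝ) else LinearIsometryEquiv.refl ℝ ℝ) y) = f i.succ y) ∧
            (∀ y, f l.succ (LinearIsometryEquiv.piLpCongrRight 2
              (fun q : Fin 3 × Fin 3 => if q.1 = kx then LinearIsometryEquiv.neg ℝ (E := ℝ) else LinearIsometryEquiv.refl ℝ ℝ) y) = -f l.succ y)) ∨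
          ((∀ y, f l.succ (LinearIsometryEquiv.piLpCongrRight 2
              (fun q : Fin 3 × Fin 3 => if q.1 = kx then LinearIsometryEquiv.neg ℝ (E := ℝ) else LinearIsometryEquiv.refl ℝ ℝ) y) = f l.succ y) ∧
            (∀ y, f i.succ (LinearIsometryEquiv.piLpCongrRight 2
              (fun q : Fin 3 × Fin 3 => if q.1 = kx then LinearIsometryEquiv.neg ℝ (E := ℝ) else LinearIsometryEquiv.refl ℝ ℝ) y) = -f i.succ y))) ∨
      (((∀ y, f i.succ (-y) = f i.succ y) ∧ (∀ y, f l.succ (-y) = -f l.succ y)) ∨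
        ((∀ y, f l.succ (-y) = f l.succ y) ∧ (∀ y, f i.succ (-y) = -f i.succ y))))
    {C : ℝ} (hC : 0 ≤ C) :
    StaticClauses k C β (dressedLiftFamily β φ (fun i => transplantObsL L Λ R f i)) := by
  have hbasis : TransplantBasisLR k L Λ (fun i => transplantObsL L Λ R f i) := ⟨f, R, hf, hpos, hR1, hlo, hhi, fun _ => rfl⟩
  refine staticClauses_transplantLR_of_pairSeparated hβ hvac hΛ hΛk hbasis (fun i l hil => ?_) hC
  rcases hcert i l hil with ⟨a, b, hab⟩ | ⟨kx, hk⟩ | hpar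
  · exact pairSeparated_transplantObsL_swap L Λ R hf hpos a b hab
  · exact pairSeparated_transplantObsL_reflect L Λ R hf hpos kx hk
  · exact pairSeparated_transplantObsL_parity L Λ R hf hpos hpar

/-! ## §2 The stub text `StaticsForL (TransplantBasisLR k)` from a separation certificate; levels `k ≤ 1` outright -/

/-- ★★ **The r7 stub text at level `k` from a basis-level separation certificate** (`C = 0`, `L0 = 0`, `lam0` from `o0_level_transplantLR`): if every pair of
channels of every r7 transplant basis at level `k` is `PairSeparated`, then `StaticsForL (TransplantBasisLR k)`. [cite: Luscher1983, §3] [cite: LuscherWolff1990] -/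
theorem staticsForLR_of_separationCert (k : ℕ)
    (hsep : ∀ (L : ℕ) (Λ : ℝ) (g : Fin k → (Cfg → ℝ)), TransplantBasisLR k L Λ g → ∀ i l : Fin k, i ≠ l → PairSeparated (g i) (g l)) :
    StaticsForL (TransplantBasisLR k) := by
  obtain ⟨lam0, hlam0, h⟩ := staticsForLR_level_of_separated k
  exact ⟨0, lam0, le_rfl, hlam0, fun lam hlam hle => ⟨0, fun L _ _ β hW φ hvac g hbasis =>
    h lam hlam hle L β hW φ hvac g hbasis (hsep L _ g hbasis)⟩⟩

/-- ★★ **Levels `k ≤ 1` of the r7 statics stub, outright**: with at most one excited channel there is no pair, (o2) is vacuous, and (o0) (`o0_level_transplantLR`)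
closes `StaticsForL (TransplantBasisLR k)`. [cite: Luscher1983, §3] -/
theorem staticsForLR_of_le_one (hk : k ≤ 1) : StaticsForL (TransplantBasisLR k) := by
  haveI : Subsingleton (Fin k) := Fin.subsingleton_iff_le_one.mpr hk
  exact staticsForLR_of_separationCert k fun _ _ _ _ i l hil => absurd (Subsingleton.elim i l) hil

/-- ★★ **Flat-sign certificate ⇒ the r7 stub text at level `k`**: if EVERY AL1 family `f` of `𝔥` at level `k` with `f_0 > 0` has every excited pair `i ≠ l` of opposite
signs under some hyperoctahedral generator (transposition, axis reflection, parity), then `StaticsForL (TransplantBasisLR k)` — the statics stub at level `k`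
reduces to a ONE-type sign classification of the low spectrum of `𝔥`. [cite: Luscher1983, §3] [cite: LuscherMunster1984, §4] -/
theorem staticsForLR_of_hyperoctCert (k : ℕ)
    (hcert : ∀ f : Fin (k + 1) → ZM → ℝ, IsEigenFamily k f → (∀ x, 0 < f 0 x) → ∀ i l : Fin k, i ≠ l →
      (∃ a b : Fin 3,
        ((∀ y, f i.succ (LinearIsometryEquiv.piLpCongrLeft 2 ℝ ℝ ((Equiv.swap a b).prodCongr (Equiv.refl (Fin 3))) y) = f i.succ y) ∧
            (∀ y, f l.succ (LinearIsometryEquiv.piLpCongrLeft 2 ℝ ℝ ((Equiv.swap a b).prodCongr (Equiv.refl (Fin 3))) y) = -f l.succ y)) ∨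
          ((∀ y, f l.succ (LinearIsometryEquiv.piLpCongrLeft 2 ℝ ℝ ((Equiv.swap a b).prodCongr (Equiv.refl (Fin 3))) y) = f l.succ y) ∧
            (∀ y, f i.succ (LinearIsometryEquiv.piLpCongrLeft 2 ℝ ℝ ((Equiv.swap a b).prodCongr (Equiv.refl (Fin 3))) y) = -f i.succ y))) ∨
      (∃ kx : Fin 3,
        ((∀ y, f i.succ (LinearIsometryEquiv.piLpCongrRight 2
              (fun q : Fin 3 × Fin 3 => if q.1 = kx then LinearIsometryEquiv.neg ℝ (E := ℝ) else LinearIsometryEquiv.refl ℝ ℝ) y) = f i.succ y) ∧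
            (∀ y, f l.succ (LinearIsometryEquiv.piLpCongrRight 2
              (fun q : Fin 3 × Fin 3 => if q.1 = kx then LinearIsometryEquiv.neg ℝ (E := ℝ) else LinearIsometryEquiv.refl ℝ ℝ) y) = -f l.succ y)) ∨
          ((∀ y, f l.succ (LinearIsometryEquiv.piLpCongrRight 2
              (fun q : Fin 3 × Fin 3 => if q.1 = kx then LinearIsometryEquiv.neg ℝ (E := ℝ) else LinearIsometryEquiv.refl ℝ ℝ) y) = f l.succ y) ∧
            (∀ y, f i.succ (LinearIsometryEquiv.piLpCongrRight 2
              (fun q : Fin 3 × Fin 3 => if q.1 = kx then LinearIsometryEquiv.neg ℝ (E := ℝ) else LinearIsometryEquiv.refl ℝ ℝ) y) = -f i.succ y))) ∨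
      (((∀ y, f i.succ (-y) = f i.succ y) ∧ (∀ y, f l.succ (-y) = -f l.succ y)) ∨
        ((∀ y, f l.succ (-y) = f l.succ y) ∧ (∀ y, f i.succ (-y) = -f i.succ y)))) :
    StaticsForL (TransplantBasisLR k) := by
  refine staticsForLR_of_separationCert k fun L Λ g hbasis i l hil => ?_
  obtain ⟨f, R, hf, hpos, -, -, -, hg⟩ := hbasis
  rw [hg i, hg l]
  rcases hcert f hf hpos i l hil with ⟨a, b, hab⟩ | ⟨kx, hk⟩ | hpar
  · exact pairSeparated_transplantObsL_swap L Λ R hf hpos a b hab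
  · exact pairSeparated_transplantObsL_reflect L Λ R hf hpos kx hk
  · exact pairSeparated_transplantObsL_parity L Λ R hf hpos hpar

end Summit.QuantumFields.YangMills.Theorems.FemtoTransferGap.PolyakovLift

end
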